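import Mathlib
import Summits.Ventures.DiscreteObjects.Mahler.CyclotomicIntegerLehmer
import Summits.Ventures.DiscreteObjects.Mahler.CyclotomicIntegerDescent
import Summits.Ventures.DiscreteObjects.Mahler.CyclotomicIntegerTwistFibre

/-!
# Cyclotomic integers: the 2-adic resultant inequalities of Amoroso–Dvornicich (venture `DiscreteObjects`, target L)

Cell `pub-namedobj`, seat `pub-namedobj-mahler-g28`. Framing: lottery ticket; floor = certified bounds/negative ranges.

F. Amoroso, R. Dvornicich, *A lower bound for the height in abelian extensions*, J. Number Theory 80 (2000) 260–272,
Lemma 3 and the first display of the proof of Proposition 2 (the prime `2` in place of the odd prime `p` of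
[cite: BombieriGubler2001, Theorem 4.4.9]): for a cyclotomic integer `γ ∈ ℤ[ζ_m]`,
(1) `4 ∤ m`: `4 ∣ γ⁴ - σγ²` for the Frobenius-type `σ` (`ζ ↦ ζ²` if `m` is odd; `ζ ↦ ζ^{2+m/2} = -ζ²` if `m ≡ 2 (mod 4)`);
(2) `4 ∣ m`: `4 ∣ γ² - σγ²` for `σ : ζ ↦ -ζ = ζ^{1+m/2}`, the generator of `Gal(ℚ(ζ_m)/ℚ(ζ_{m/2}))`.
KERNEL FORM over `ℂ` by resultants, as in `CyclotomicIntegerMeasure` / `CyclotomicIntegerRamified`, with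
`H = ∏_μ max(1,|g(μ)|)` over the primitive `m`-th roots of unity:
* `two_pow_totient_le_of_four_dvd_poly`: the common resultant estimate `2^{φ(m)} ≤ H^{a+b}` from `V = 4U`,
  `V(μ) = g(μ)^a - g(μ^k)^b ≠ 0`;
* `two_pow_totient_le_of_odd`, `two_pow_totient_le_of_two_mod_four`: **`4 ∤ m` ⇒ `2^{φ(m)} ≤ H^6`** for `g(ζ_m) ≠ 0` not a
  root of unity (nondegeneracy is automatic: `pow_four_ne_aeval_pow_sq_of_not_torsion`), i.e. `h(α) ≥ (log 2)/6`;
* `two_pow_totient_le_of_four_dvd`: **`4 ∣ m`, `g(μ)² ≠ g(-μ)²` ⇒ `2^{φ(m)} ≤ H^4`**, i.e. `h(α) ≥ (log 2)/4`.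
(The published theorem, `h(α) ≥ (log 5)/12`, refines the archimedean estimate — A–D Lemma 4 — and is not reproduced;
with the trivial archimedean bound the method gives `(log 2)/6`, assembled for all `m` in `CyclotomicIntegerLehmerTwo`.)
REPLICATION of the published method; no new mathematics claimed.
-/

namespace Summit.Ventures.DiscreteObjects.Mahler

open Polynomial Finset

/-- **The 2-adic resultant inequality** (kernel form of [Amoroso–Dvornicich 2000, Lemma 3]: "`4 ∣ γ⁴ - σγ²`" resp.
"`4 ∣ γ² - σγ²`").  Let `m ≥ 1`, `k` prime to `m`, `g, V, U ∈ ℤ[X]` with `V = 4U` and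
`V(μ) = g(μ)^a - g(μ^k)^b` for every primitive `m`-th root of unity `μ`.  If `g(μ)^a ≠ g(μ^k)^b` for every primitive
`μ`, then `2^{φ(m)} ≤ (∏_μ max(1,|g(μ)|))^{a+b}`: `Res(Φ_m, V) = 4^{φ(m)} Res(Φ_m, U)` is a nonzero integer, while over `ℂ`
it is `∏_μ (g(μ)^a - g(μ^k)^b)`, of modulus `≤ 2^{φ(m)} H^a H^b` (`μ ↦ μ^k` permutes the primitive roots). -/
theorem two_pow_totient_le_of_four_dvd_poly {m k a b : ℕ} (hm : 0 < m) (hkcop : k.Coprime m) (g V U : ℤ[X])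
    (hVU : V = C (4 : ℤ) * U) (hVμ : ∀ μ ∈ primitiveRoots m ℂ, aeval μ V = aeval μ g ^ a - aeval (μ ^ k) g ^ b)
    (hsep : ∀ μ ∈ primitiveRoots m ℂ, aeval μ g ^ a ≠ aeval (μ ^ k) g ^ b) :
    (2 : ℝ) ^ m.totient ≤ (∏ μ ∈ primitiveRoots m ℂ, max 1 ‖aeval μ g‖) ^ (a + b) := by
  classical
  set Φ : ℤ[X] := cyclotomic m ℤ with hΦ
  have hΦmon : Φ.Monic := cyclotomic.monic m ℤ
  have hΦdeg : Φ.natDegree = m.totient := natDegree_cyclotomic m ℤ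
  set ζ₀ : ℂ := Complex.exp (2 * Real.pi * Complex.I / m) with hζ₀def
  have hζ₀ : IsPrimitiveRoot ζ₀ m := Complex.isPrimitiveRoot_exp m hm.ne'
  have hroots : (Φ.map (Int.castRingHom ℂ)).roots = (primitiveRoots m ℂ).val := by
    rw [hΦ, map_cyclotomic_int, cyclotomic_eq_prod_X_sub_primitiveRoots hζ₀, roots_prod_X_sub_C]
  have hlc : (Φ.map (Int.castRingHom ℂ)).leadingCoeff = 1 := (hΦmon.map _).leadingCoeff
  have hcard : (primitiveRoots m ℂ).card = m.totient := hζ₀.card_primitiveRoots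
  -- `∏_μ V(μ) = Res(Φ, V) = 4^φ Res(Φ, U)`, a nonzero integer
  set N : ℕ := V.natDegree with hN
  have hRes : Φ.resultant V Φ.natDegree N = (4 : ℤ) ^ Φ.natDegree * Φ.resultant U Φ.natDegree N := by
    rw [hVU, resultant_C_mul_right]
  have hev : ((Φ.resultant V Φ.natDegree N : ℤ) : ℂ) =
      ∏ μ ∈ primitiveRoots m ℂ, (aeval μ g ^ a - aeval (μ ^ k) g ^ b) := by
    rw [resultant_intCast_eq le_rfl, hlc, one_pow, one_mul, hroots]
    change ∏ μ ∈ primitiveRoots m ℂ, (V.map (Int.castRingHom ℂ)).eval μ = _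
    refine Finset.prod_congr rfl fun μ hμ => ?_
    rw [eval_map, ← algebraMap_int_eq, ← aeval_def, hVμ μ hμ]
  have hne : Φ.resultant V Φ.natDegree N ≠ 0 := by
    intro h0
    have h := hev
    rw [h0, Int.cast_zero] at h
    exact (Finset.prod_ne_zero_iff.2 fun μ hμ => sub_ne_zero.2 (hsep μ hμ)) h.symm
  -- lower bound `4^φ ≤ |Res|`
  have hlow : (4 : ℝ) ^ m.totient ≤ ‖((Φ.resultant V Φ.natDegree N : ℤ) : ℂ)‖ := by
    have hU0 : Φ.resultant U Φ.natDegree N ≠ 0 := by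
      intro h0
      rw [h0, mul_zero] at hRes
      exact hne hRes
    have h1 : (1 : ℝ) ≤ |(Φ.resultant U Φ.natDegree N : ℝ)| := by exact_mod_cast Int.one_le_abs hU0
    rw [Complex.norm_intCast, hRes, ← hΦdeg]
    push_cast
    rw [abs_mul, abs_pow, show |(4 : ℝ)| = 4 by norm_num]
    calc (4 : ℝ) ^ Φ.natDegree = (4 : ℝ) ^ Φ.natDegree * 1 := (mul_one _).symm
      _ ≤ (4 : ℝ) ^ Φ.natDegree * |(Φ.resultant U Φ.natDegree N : ℝ)| :=
          mul_le_mul_of_nonneg_left h1 (by positivity)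
  -- upper bound `|Res| ≤ 2^φ H^a H^b`
  set H : ℝ := ∏ μ ∈ primitiveRoots m ℂ, max 1 ‖aeval μ g‖ with hH
  have hH0 : 0 ≤ H := Finset.prod_nonneg fun μ _ => by positivity
  have hup : ‖((Φ.resultant V Φ.natDegree N : ℤ) : ℂ)‖ ≤ 2 ^ m.totient * H ^ a * H ^ b := by
    rw [hev, norm_prod]
    calc ∏ μ ∈ primitiveRoots m ℂ, ‖aeval μ g ^ a - aeval (μ ^ k) g ^ b‖
        ≤ ∏ μ ∈ primitiveRoots m ℂ, (2 * (max 1 ‖aeval μ g‖) ^ a * (max 1 ‖aeval (μ ^ k) g‖) ^ b) := by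
          refine Finset.prod_le_prod (fun μ _ => norm_nonneg _) fun μ _ => ?_
          have ha : ‖aeval μ g ^ a‖ ≤ (max 1 ‖aeval μ g‖) ^ a := by
            rw [norm_pow]; exact pow_le_pow_left₀ (norm_nonneg _) (le_max_right _ _) _
          have hb : ‖aeval (μ ^ k) g ^ b‖ ≤ (max 1 ‖aeval (μ ^ k) g‖) ^ b := by
            rw [norm_pow]; exact pow_le_pow_left₀ (norm_nonneg _) (le_max_right _ _) _
          calc ‖aeval μ g ^ a - aeval (μ ^ k) g ^ b‖ ≤ ‖aeval μ g ^ a‖ + ‖aeval (μ ^ k) g ^ b‖ := norm_sub_le _ _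
            _ ≤ (max 1 ‖aeval μ g‖) ^ a + (max 1 ‖aeval (μ ^ k) g‖) ^ b := add_le_add ha hb
            _ ≤ 2 * (max 1 ‖aeval μ g‖) ^ a * (max 1 ‖aeval (μ ^ k) g‖) ^ b :=
                add_le_two_mul_mul (one_le_pow₀ (le_max_left _ _)) (one_le_pow₀ (le_max_left _ _))
      _ = 2 ^ m.totient * H ^ a * (∏ μ ∈ primitiveRoots m ℂ, max 1 ‖aeval (μ ^ k) g‖) ^ b := by
          rw [Finset.prod_mul_distrib, Finset.prod_mul_distrib, Finset.prod_const, hcard, Finset.prod_pow,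
            Finset.prod_pow]
      _ = 2 ^ m.totient * H ^ a * H ^ b := by
          rw [prod_primitiveRoots_pow_eq hm hkcop (fun z => max 1 ‖aeval z g‖)]
  -- combine: `4^φ ≤ 2^φ H^(a+b)`
  have h := hlow.trans hup
  have h4 : (4 : ℝ) ^ m.totient = 2 ^ m.totient * 2 ^ m.totient := by rw [← mul_pow]; norm_num
  rw [h4] at h
  have h2pos : (0 : ℝ) < 2 ^ m.totient := by positivity
  rw [pow_add]
  nlinarith

/-- The case `V = g⁴ - R²` with `g² - R = 2T`, `R(μ) = g(μ^k)` (conductor odd or `≡ 2 (mod 4)`): `g⁴ - R² = 4·T(g² - T)`,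
so `2^{φ(m)} ≤ H^6` in the nondegenerate case. -/
theorem two_pow_totient_le_of_sq_congr {m k : ℕ} (hm : 0 < m) (hkcop : k.Coprime m) (g R T : ℤ[X])
    (hT : g ^ 2 - R = C (2 : ℤ) * T) (hR : ∀ μ ∈ primitiveRoots m ℂ, aeval μ R = aeval (μ ^ k) g)
    (hsep : ∀ μ ∈ primitiveRoots m ℂ, aeval μ g ^ 4 ≠ aeval (μ ^ k) g ^ 2) :
    (2 : ℝ) ^ m.totient ≤ (∏ μ ∈ primitiveRoots m ℂ, max 1 ‖aeval μ g‖) ^ 6 := by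
  have hC2 : (C (2 : ℤ) : ℤ[X]) = 2 := by simp
  have hC4 : (C (4 : ℤ) : ℤ[X]) = 4 := by simp
  have hR' : R = g ^ 2 - C (2 : ℤ) * T := by rw [← hT]; ring
  have hVU : g ^ 4 - R ^ 2 = C (4 : ℤ) * (T * (g ^ 2 - T)) := by
    rw [hR', hC2, hC4]; ring
  have hVμ : ∀ μ ∈ primitiveRoots m ℂ, aeval μ (g ^ 4 - R ^ 2) = aeval μ g ^ 4 - aeval (μ ^ k) g ^ 2 := by
    intro μ hμ
    rw [map_sub, map_pow, map_pow, hR μ hμ]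
  exact two_pow_totient_le_of_four_dvd_poly hm hkcop g _ _ hVU hVμ hsep

/-- **Nondegeneracy from non-torsion** for the 2-adic inequality: with `g, R` as above (`R(μ) = g(μ^k)` on the primitive
`m`-th roots, `k` prime to `m`), if `g(ζ)` is neither `0` nor a root of unity then `g(μ)⁴ ≠ g(μ^k)²` for every
primitive `μ` (else `|g(ζ^{k^i})|² = |g(ζ)|^{2^{i+1}}` for all `i` and `k^{φ(m)} ≡ 1` force `g(ζ)^{2^{φ(m)+1}-2} = 1`). -/
theorem pow_four_ne_aeval_pow_sq_of_not_torsion {m k : ℕ} (hm : 0 < m) (hkcop : k.Coprime m) (g R : ℤ[X])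
    (hR : ∀ μ ∈ primitiveRoots m ℂ, aeval μ R = aeval (μ ^ k) g) {ζ : ℂ} (hζ : IsPrimitiveRoot ζ m)
    (h0 : aeval ζ g ≠ 0) (hnu : ∀ j : ℕ, 0 < j → aeval ζ g ^ j ≠ 1) :
    ∀ μ ∈ primitiveRoots m ℂ, aeval μ g ^ 4 ≠ aeval (μ ^ k) g ^ 2 := by
  intro μ hμ heq
  have hμ' := (mem_primitiveRoots hm).1 hμ
  set Q : ℤ[X] := g ^ 4 - R ^ 2 with hQ
  have hQμ : aeval μ Q = 0 := by
    rw [hQ, map_sub, map_pow, map_pow, hR μ hμ, heq, sub_self]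
  have hstep : ∀ ν : ℂ, IsPrimitiveRoot ν m → aeval ν g ^ 4 = aeval (ν ^ k) g ^ 2 := by
    intro ν hν
    have h := aeval_eq_zero_of_primitiveRoot hm hμ' hQμ hν
    rw [hQ, map_sub, map_pow, map_pow, hR ν ((mem_primitiveRoots hm).2 hν), sub_eq_zero] at h
    exact h
  -- `a_i = g(ζ^{k^i})` satisfies `a_i² = a_0^{2^{i+1}}`
  have hiter : ∀ i : ℕ, aeval (ζ ^ k ^ i) g ^ 2 = aeval ζ g ^ 2 ^ (i + 1) := by
    intro i
    induction i with
    | zero => simp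
    | succ i ih =>
      have hprim : IsPrimitiveRoot (ζ ^ k ^ i) m := hζ.pow_of_coprime _ (Nat.Coprime.pow_left i hkcop)
      have h := hstep _ hprim
      rw [← pow_mul, ← pow_succ] at h
      rw [← h, show (4 : ℕ) = 2 * 2 from rfl, pow_mul, ih, ← pow_mul, ← pow_succ]
  have hE : (k ^ m.totient) % m = 1 % m := Nat.ModEq.pow_totient hkcop
  have key := hiter m.totient
  rw [pow_eq_self_of_mod_eq hm hζ hE] at key
  -- `a_0² = a_0^{2^{φ+1}}`, so `a_0^{2^{φ+1} - 2} = 1`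
  have htot : 0 < m.totient := Nat.totient_pos.2 hm
  have hge : 4 ≤ 2 ^ (m.totient + 1) := by
    calc 4 = 2 ^ 2 := by norm_num
      _ ≤ 2 ^ (m.totient + 1) := Nat.pow_le_pow_right (by norm_num) (by omega)
  have hone : aeval ζ g ^ (2 ^ (m.totient + 1) - 2) = 1 := by
    have h2 : aeval ζ g ^ (2 ^ (m.totient + 1) - 2) * aeval ζ g ^ 2 = 1 * aeval ζ g ^ 2 := by
      rw [← pow_add, Nat.sub_add_cancel (by omega), ← key, one_mul]
    exact mul_right_cancel₀ (pow_ne_zero _ h0) h2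
  exact hnu _ (by omega) hone

/-- `g² - g(X²) = 2 T` (Frobenius at `2`). -/
theorem exists_sq_sub_expand_two (g : ℤ[X]) : ∃ T : ℤ[X], g ^ 2 - expand ℤ 2 g = C (2 : ℤ) * T := by
  obtain ⟨T, hT⟩ := exists_pow_sub_expand_eq_prime_mul g Nat.prime_two
  exact ⟨T, by exact_mod_cast hT⟩

/-- `g(X) - g(-X) = 2 O` (the odd part). -/
theorem exists_sub_comp_neg_X (g : ℤ[X]) : ∃ O : ℤ[X], g - g.comp (-X) = C (2 : ℤ) * O := by
  induction g using Polynomial.induction_on' with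
  | add f h hf hh =>
    obtain ⟨O₁, h₁⟩ := hf
    obtain ⟨O₂, h₂⟩ := hh
    refine ⟨O₁ + O₂, ?_⟩
    rw [add_comp, show f + h - (f.comp (-X) + h.comp (-X)) = (f - f.comp (-X)) + (h - h.comp (-X)) by ring, h₁, h₂]
    ring
  | monomial i a =>
    have hC2 : (C (2 : ℤ) : ℤ[X]) = 2 := by simp
    rcases Nat.even_or_odd i with hi | hi
    · refine ⟨0, ?_⟩
      rw [← C_mul_X_pow_eq_monomial, mul_comp, C_comp, X_pow_comp, hi.neg_pow, mul_zero, sub_self]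
    · refine ⟨C a * X ^ i, ?_⟩
      rw [← C_mul_X_pow_eq_monomial, mul_comp, C_comp, X_pow_comp, hi.neg_pow, hC2]
      ring

/-- **`m` odd: `2^{φ(m)} ≤ (∏_μ max(1,|g(μ)|))^6`** for `g(ζ_m) ≠ 0` not a root of unity (`σ: ζ ↦ ζ²`). -/
theorem two_pow_totient_le_of_odd {m : ℕ} (hm : 0 < m) (hodd : ¬ 2 ∣ m) (g : ℤ[X]) {ζ : ℂ} (hζ : IsPrimitiveRoot ζ m)
    (h0 : aeval ζ g ≠ 0) (hnu : ∀ j : ℕ, 0 < j → aeval ζ g ^ j ≠ 1) :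
    (2 : ℝ) ^ m.totient ≤ (∏ μ ∈ primitiveRoots m ℂ, max 1 ‖aeval μ g‖) ^ 6 := by
  have hkcop : (2 : ℕ).Coprime m := (Nat.Prime.coprime_iff_not_dvd Nat.prime_two).2 hodd
  obtain ⟨T, hT⟩ := exists_sq_sub_expand_two g
  have hR : ∀ μ ∈ primitiveRoots m ℂ, aeval μ (expand ℤ 2 g) = aeval (μ ^ 2) g := fun μ _ => expand_aeval 2 g μ
  exact two_pow_totient_le_of_sq_congr hm hkcop g _ T hT hR
    (pow_four_ne_aeval_pow_sq_of_not_torsion hm hkcop g _ hR hζ h0 hnu)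

/-- **`m ≡ 2 (mod 4)`: `2^{φ(m)} ≤ (∏_μ max(1,|g(μ)|))^6`** for `g(ζ_m) ≠ 0` not a root of unity (`σ: ζ ↦ ζ^{2+m/2} = -ζ²`;
`g² - g(-X²) = (g² - g(X²)) + (g(X²) - g(-X²)) ≡ 0 (mod 2)`). -/
theorem two_pow_totient_le_of_two_mod_four {m : ℕ} (hm : 0 < m) (h2 : 2 ∣ m) (h4 : ¬ 4 ∣ m) (g : ℤ[X]) {ζ : ℂ}
    (hζ : IsPrimitiveRoot ζ m) (h0 : aeval ζ g ≠ 0) (hnu : ∀ j : ℕ, 0 < j → aeval ζ g ^ j ≠ 1) :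
    (2 : ℝ) ^ m.totient ≤ (∏ μ ∈ primitiveRoots m ℂ, max 1 ‖aeval μ g‖) ^ 6 := by
  obtain ⟨n, hn⟩ := h2
  have hnodd : ¬ 2 ∣ n := by
    intro h; apply h4; obtain ⟨q, hq⟩ := h; exact ⟨q, by rw [hn, hq]; ring⟩
  have hn0 : 0 < n := by
    rcases Nat.eq_zero_or_pos n with h | h
    · rw [h, mul_zero] at hn; omega
    · exact h
  set k : ℕ := 2 + n with hk
  have hkcop : k.Coprime m := by
    rw [hn, hk]
    refine Nat.Coprime.mul_right ?_ ?_
    · exact ((Nat.Prime.coprime_iff_not_dvd Nat.prime_two).2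
        (fun h => hnodd ((Nat.dvd_add_right (dvd_refl 2)).1 h))).symm
    · rw [show 2 + n = 2 + 1 * n by ring, Nat.coprime_add_mul_right_left]
      exact (Nat.Prime.coprime_iff_not_dvd Nat.prime_two).2 hnodd
  -- `R = (g ∘ (-X))(X²)`
  obtain ⟨T₁, hT₁⟩ := exists_sq_sub_expand_two g
  obtain ⟨O, hO⟩ := exists_sub_comp_neg_X g
  set R : ℤ[X] := expand ℤ 2 (g.comp (-X)) with hRdef
  have hT : g ^ 2 - R = C (2 : ℤ) * (T₁ + expand ℤ 2 O) := by
    have h1 : g ^ 2 - R = (g ^ 2 - expand ℤ 2 g) + expand ℤ 2 (g - g.comp (-X)) := by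
      rw [hRdef, map_sub]; ring
    rw [h1, hT₁, hO, map_mul, expand_C]; ring
  have hR : ∀ μ ∈ primitiveRoots m ℂ, aeval μ R = aeval (μ ^ k) g := by
    intro μ hμ
    have hμ' := (mem_primitiveRoots hm).1 hμ
    have hhalf : μ ^ n = -1 := by
      have h2 : IsPrimitiveRoot (μ ^ n) 2 := hμ'.pow hm (by rw [hn, mul_comm])
      exact h2.eq_neg_one_of_two_right
    have hμk : μ ^ k = -(μ ^ 2) := by rw [hk, pow_add, hhalf]; ring
    rw [hRdef, expand_aeval, aeval_comp, map_neg, aeval_X, hμk]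
  exact two_pow_totient_le_of_sq_congr hm hkcop g R _ hT hR
    (pow_four_ne_aeval_pow_sq_of_not_torsion hm hkcop g R hR hζ h0 hnu)

/-- `1 + m/2` is prime to `m` when `4 ∣ m`. -/
theorem coprime_one_add_half {m : ℕ} (h4 : 4 ∣ m) : (1 + m / 2).Coprime m := by
  obtain ⟨q, hq⟩ := h4
  have hhalf : m / 2 = 2 * q := by rw [hq, show 4 * q = 2 * (2 * q) by ring, Nat.mul_div_cancel_left _ (by norm_num)]
  rw [hhalf, hq, show 4 * q = 2 ^ 2 * q by norm_num]
  refine Nat.Coprime.mul_right (Nat.Coprime.pow_right 2 ?_) ?_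
  · exact ((Nat.Prime.coprime_iff_not_dvd Nat.prime_two).2 (by omega)).symm
  · rw [show 1 + 2 * q = 1 + q * 2 by ring, Nat.coprime_add_mul_left_left]
    exact Nat.coprime_one_left q

/-- For `4 ∣ m` (indeed `2 ∣ m`) and `μ` a primitive `m`-th root of unity: `μ^{1+m/2} = -μ`. -/
theorem pow_one_add_half_eq_neg {m : ℕ} (hm : 0 < m) (h2 : 2 ∣ m) {μ : ℂ} (hμ : IsPrimitiveRoot μ m) :
    μ ^ (1 + m / 2) = -μ := by
  have hhalf : IsPrimitiveRoot (μ ^ (m / 2)) 2 := hμ.pow hm (Nat.div_mul_cancel h2).symm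
  rw [pow_add, pow_one, hhalf.eq_neg_one_of_two_right]; ring

/-- **`4 ∣ m`, nondegenerate case: `2^{φ(m)} ≤ (∏_μ max(1,|g(μ)|))^4`** ([Amoroso–Dvornicich 2000, Lemma 3 (2) /
Proposition 2 (1)] in kernel form, `h(α) ≥ log 2/4`): `g(X)² - g(-X)² = 4·O·(g - O)` with `g - g(-X) = 2O`, and
`∏_μ (g(μ)² - g(-μ)²) = Res(Φ_m, ·)` is then a nonzero multiple of `4^{φ(m)}` of modulus `≤ 2^{φ(m)} H² H²`. -/
theorem two_pow_totient_le_of_four_dvd {m : ℕ} (hm : 0 < m) (h4 : 4 ∣ m) (g : ℤ[X])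
    (hsep : ∀ μ ∈ primitiveRoots m ℂ, aeval μ g ^ 2 ≠ aeval (μ ^ (1 + m / 2)) g ^ 2) :
    (2 : ℝ) ^ m.totient ≤ (∏ μ ∈ primitiveRoots m ℂ, max 1 ‖aeval μ g‖) ^ 4 := by
  have h2 : 2 ∣ m := dvd_trans (by norm_num) h4
  obtain ⟨O, hO⟩ := exists_sub_comp_neg_X g
  have hC2 : (C (2 : ℤ) : ℤ[X]) = 2 := by simp
  have hC4 : (C (4 : ℤ) : ℤ[X]) = 4 := by simp
  have hneg : g.comp (-X) = g - C (2 : ℤ) * O := by rw [← hO]; ring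
  have hVU : g ^ 2 - (g.comp (-X)) ^ 2 = C (4 : ℤ) * (O * (g - O)) := by
    rw [hneg, hC2, hC4]; ring
  have hVμ : ∀ μ ∈ primitiveRoots m ℂ,
      aeval μ (g ^ 2 - (g.comp (-X)) ^ 2) = aeval μ g ^ 2 - aeval (μ ^ (1 + m / 2)) g ^ 2 := by
    intro μ hμ
    rw [map_sub, map_pow, map_pow, aeval_comp, map_neg, aeval_X,
      pow_one_add_half_eq_neg hm h2 ((mem_primitiveRoots hm).1 hμ)]
  exact two_pow_totient_le_of_four_dvd_poly hm (coprime_one_add_half h4) g _ _ hVU hVμ hsep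

end Summit.Ventures.DiscreteObjects.Mahler
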